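import Summits.AnomalousDissipation.AnomalousDissipation.Theses.LimitingAbsorption
import Summits.AnomalousDissipation.AnomalousDissipation.Theses.TwoAndHalfD
import Summits.AnomalousDissipation.AnomalousDissipation.Theorems.LimitingAbsorptionAssembly
import Summits.AnomalousDissipation.AnomalousDissipation.Theorems.LimitingAbsorptionRelaxationBoundsInventory
import Summits.AnomalousDissipation.AnomalousDissipation.Theorems.LimitingAbsorptionScalarSectorLift
import Summits.AnomalousDissipation.AnomalousDissipation.Theorems.TwoAndHalfDTwohalfdThesisSiblingReduction
import Summits.AnomalousDissipation.AnomalousDissipation.Theorems.UniformRelaxationWitness.Negative.SeisTransfer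
import Summits.AnomalousDissipation.AnomalousDissipation.Theorems.RelaxingFamily.Negative.SublogBudget
import HarnessLib

/-!
# Strategist r1 (REDIRECT) — crux `UniformRelaxationWitness` (stmt-AnomalousDissipation-2937), typed companion of
`STRATEGY-CENSUS.md`

Seat `planner-cstrat-stmt-AnomalousDissipation-2937-r1-0`, 2026-08-17. Route
`route-AnomalousDissipation-LimitingAbsorption` (rev 9; `closes hR hF hInv hLift`, X = `UniformRelaxationWitness`
the derived node `hF hR`). Everything below is sorry-free; nothing here is new mathematics — it is the
PLACEMENT of the crux relative to the summit and to the sibling route `TwoAndHalfD`, and the typed objects the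
census refers to (Transfer §T, Strengthen §S, Decomposition §D, Negation §N).

§P PLACEMENT (the theorems showing the crux is the summit-or-harder in costume):
* `crux_implies_summit : X → AnomalousDissipation` — the route's own chain, composed from LANDED theorems
  (`limitingAbsorption_assembly_proof`, `relaxationBoundsInventory_proof`, `scalarSectorLift_proof`): X ⇒ S certified.
* `crux_implies_crux0448 : X → TwoAndHalfD.ScalarAnomalySteadySourceFormal` — X is a STRICT strengthening of the
  sibling route's open rank-2 crux #2 (stmt-0448: inventory form, no uniform relaxation asked), hence of
  `TwoAndHalfD.TwohalfdThesis` (stmt-0206, `crux_implies_crux0206`, by the landed sibling reduction p133429), and the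
  sibling's negative crux `TwohalfdNeg` (stmt-0211) kills X (`not_crux_of_crux0211`).
  So X ≥ #2 ⇔ 0206 ≥ S, all by name; no converse of any arrow is known or expected.
* `crux_implies_relaxingFamily : X → RelaxingFamily` (crux r3 of this route, landed Part A) and `crux_implies_both`:
  X dominates BOTH cruxes that already carry `no-strategy-short-of-summit` censuses (r3 here, #2 of TwoAndHalfD).
§T TRANSFER: `crux_iff_kinematic_realised` — X is LITERALLY "a kinematic witness (locally bounded fields of bounded
  mean energy that relax `h` ν-uniformly from every phase, with the absorbed-power floor) whose fields are
  STEADILY REALISED (global Leray–Hopf for ONE steady smooth force)". The kinematic conjunct is a theorem in kind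
  (Hess-Childs–Rowan 2025b Cor 1.2 = `Literature.Analysis.FluidPDE.HessChildsRowan2025_cor12`, + the steady-source
  floor for designed fields); `SteadilyRealised` along ν → 0 is the whole crux.
§S STRENGTHEN: `crux_of_strengthening` over the landed receptacle `UniformRelaxationWitnessUnder`; the three rigid
  classes tried (`PeriodicStates`, `AllProfiles`, `PointwiseEnergy`) are typed here; none buys the ν-uniform constant.
§D DECOMPOSITION: the existing split `crux_of_existingSplit : RelaxingFamily → FloorUpgrade → X` (modus ponens; both
  pieces carry STRATEGY-CENSUS verdicts `no-strategy-short-of-summit`, 2026-08-17), and the only other shape a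
  two-piece split can take, `crux_of_classSplit A : ClassRelaxes A h → ClassRealised A → X` for an a-priori class
  `A` of admissible families — with `classSplit_degenerate` recording that the choice `A := ScalarClauses · · h`
  makes the first piece trivial and the second piece X itself (costume); the census explains why every Eulerian
  `A` makes piece 1 false and every Lagrangian `A` makes piece 2 ⊇ crux.
§N NEGATION: `not_crux_of_not_relaxingFamily` (landed) and `not_crux_of_sublogStrainLaw : SublogStrainLaw → ¬ X`
  — ¬X is EXACTLY as far as a ν-uniform sub-logarithmic windowed-strain law for bounded-energy steadily forced
  planar Leray–Hopf families (Kraichnan–Batchelor side; proved only `⟨‖∇v‖²⟩ ≲ ν^{-1/2}`, Alexakis–Doering).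
-/

noncomputable section

open MeasureTheory Set Filter Topology
open scoped ENNReal NNReal
open Literature.Analysis.FunctionSpaces Literature.Analysis.FunctionSpaces.Torus
open Literature.Analysis.FluidPDE Literature.Analysis.FluidPDE.Torus
open Summit.AnomalousDissipation.AnomalousDissipation.Theses
open Summit.AnomalousDissipation.AnomalousDissipation.Theses.LimitingAbsorption
open Summit.AnomalousDissipation.AnomalousDissipation.Theorems
open Summit.AnomalousDissipation.AnomalousDissipation.Theorems.RelaxingFamily.Negative
open Summit.AnomalousDissipation.AnomalousDissipation.Theorems.UniformRelaxationWitness.Negative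

-- D-0017: single-problem summit ⇒ `Summit.AnomalousDissipation.AnomalousDissipation.…` by design.
set_option linter.dupNamespace false

namespace Summit.AnomalousDissipation.AnomalousDissipation.Cruxes.UniformRelaxationWitness.StrategistR1

/-- The unit flat 2-torus (local notation). -/
local notation "𝕋²" => UnitAddTorus (Fin 2)
/-- Planar vectors (local notation). -/
local notation "E²" => EuclideanSpace ℝ (Fin 2)

/-! ## §P Placement: the crux is the summit-or-harder -/

/-- **X ⇒ S, certified.** The route's chain `Assembly` ∘ (`RelaxationBoundsInventory`, `ScalarSectorLift`),
all three LANDED (stmt-2942, stmt-2940, stmt-2941 closed `proved`). [route AnomalousDissipation/LimitingAbsorption] -/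
theorem crux_implies_summit (hX : UniformRelaxationWitness) : _root_.AnomalousDissipation :=
  limitingAbsorption_assembly_proof relaxationBoundsInventory_proof hX scalarSectorLift_proof

/-- **X ⇒ sibling crux #2 of route `TwoAndHalfD`** (`ScalarAnomalySteadySourceFormal`, stmt-0448: the
mechanism-free scalar-sector witness — bounded scalar inventory + dissipation floor, NO uniform relaxation):
take the (ABS) scalar of the X-witness from zero datum and bound its inventory by `4C/γ² · ‖h‖²` through the
landed `relaxationBoundsInventory_proof`. X is therefore a STRICT strengthening of an open sibling crux.
[route AnomalousDissipation/LimitingAbsorption; folklore bookkeeping] -/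
theorem crux_implies_crux0448 (hX : UniformRelaxationWitness) : TwoAndHalfD.ScalarAnomalySteadySourceFormal := by
  obtain ⟨g, h, hg, hgdiv, hgmean, hh, hhmean, ν, v₀, v, hνpos, hνlim, hLH, hbd, ⟨E, hE⟩,
    ⟨C, γ, hC, hγ, hrelax⟩, ε, hε, hdiss⟩ := hX
  choose θ hθ hθε using hdiss
  exact ⟨g, h, hg, hgdiv, hgmean, hh, hhmean, ν, v₀, v, fun _ => 0, θ, hνpos, hνlim, hLH,
    fun _ => MeasureTheory.MemLp.zero, hθ, ⟨E, hE⟩,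
    ⟨4 * C / γ ^ 2 * scalarL2Sq h, fun j =>
      relaxationBoundsInventory_proof (ν j) (v j) h C γ (hνpos j) hC hγ (hh.memLp 2) (hbd j)
        (hrelax j) (θ j) (hθ j)⟩, ε, hε, hθε⟩

/-- **X ⇒ `TwoAndHalfD.TwohalfdThesis`** (stmt-0206), by the landed sibling reduction `#2 → 0206` (p133429).
[route AnomalousDissipation/LimitingAbsorption] -/
theorem crux_implies_crux0206 (hX : UniformRelaxationWitness) : TwoAndHalfD.TwohalfdThesis :=
  TwohalfdThesis.twohalfdThesis_of_scalarAnomalySteadySourceFormal (crux_implies_crux0448 hX)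

/-- **The sibling's negative crux kills X**: `TwohalfdNeg` (stmt-0211) `→ ¬ X`. [route AnomalousDissipation/LimitingAbsorption] -/
theorem not_crux_of_crux0211 (h5 : TwoAndHalfD.TwohalfdNeg) : ¬ UniformRelaxationWitness := fun hX =>
  (TwohalfdThesis.twohalfdNeg_iff_not_scalarAnomalySteadySourceFormal.1 h5) (crux_implies_crux0448 hX)

/-- **X ⇒ crux r3 of its own route** (`RelaxingFamily`, stmt-15009): the profile of an X-witness is nonzero
((ABS) sees the source, Disproof Part A, landed in `Negative/SeisTransfer.lean`). r3 carries its own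
`no-strategy-short-of-summit` census (Cruxes/RelaxingFamily/STRATEGY-CENSUS.md, 2026-08-17). [route AnomalousDissipation/LimitingAbsorption] -/
theorem crux_implies_relaxingFamily (hX : UniformRelaxationWitness) : RelaxingFamily :=
  (uniformRelaxationWitnessUnder_true_iff.2 hX).relaxingFamilyUnder.relaxingFamily

/-- So X sits above BOTH census-graded cruxes at once: `X → RelaxingFamily ∧ TwoAndHalfD.ScalarAnomalySteadySourceFormal`.
[route AnomalousDissipation/LimitingAbsorption] -/
theorem crux_implies_both (hX : UniformRelaxationWitness) :
    RelaxingFamily ∧ TwoAndHalfD.ScalarAnomalySteadySourceFormal :=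
  ⟨crux_implies_relaxingFamily hX, crux_implies_crux0448 hX⟩

/-! ## §T Transfer: X = kinematic sibling + steady realisation -/

/-- Kinematic admissibility of a family `(ν, v)`: positive viscosities tending to zero, fields locally bounded on
every `(0,T) × 𝕋²`, bounded limsup-mean energy — X's velocity clauses MINUS the Navier–Stokes one. -/
def KinematicBudget (ν : ℕ → ℝ) (v : ℕ → ℝ → 𝕋² → E²) : Prop :=
  (∀ j, 0 < ν j) ∧ Tendsto ν atTop (𝓝 0) ∧
    (∀ j (T : ℝ), 0 < T → MemLp (stLift (v j)) ⊤ (volume.restrict (Ioo (0 : ℝ) T ×ˢ univ))) ∧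
    ∃ E : ℝ, ∀ j, meanEnergy (v j) ≤ E

/-- The two scalar clauses of X for a family `(ν, v)` and a profile `h`: (U_h) = `RelaxesUniformly` with some
`(C, γ)`, and (ABS) = the ν-uniform absorbed-power floor of the `h`-sourced scalar from zero datum. -/
def ScalarClauses (ν : ℕ → ℝ) (v : ℕ → ℝ → 𝕋² → E²) (h : 𝕋² → ℝ) : Prop :=
  (∃ C γ : ℝ, 0 ≤ C ∧ 0 < γ ∧ RelaxesUniformly ν v h C γ) ∧
    ∃ ε : ℝ, 0 < ε ∧ ∀ j : ℕ, ∃ θ : ℝ → 𝕋² → ℝ,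
      IsWeakScalarTransportForced (ν j) (v j) (fun _ => h) 0 θ ∧
      ε ≤ longTimeAvgSup (fun t => ν j * (eScalarGradNormSq (θ t)).toReal)

/-- Steady realisation: the SAME fields are global Leray–Hopf solutions of planar Navier–Stokes for ONE steady,
smooth, divergence-free, mean-zero force. This is the conjunct no solved sibling delivers. -/
def SteadilyRealised (ν : ℕ → ℝ) (v : ℕ → ℝ → 𝕋² → E²) : Prop :=
  ∃ g : 𝕋² → E², IsSmooth g ∧ IsDivFree g ∧ HasZeroMean g ∧
    ∃ v₀ : ℕ → 𝕋² → E², ∀ j, IsGlobalLerayHopf (ν j) (fun _ => g) (v₀ j) (v j)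

/-- The kinematic sibling of X (Hess-Childs–Rowan 2025b shape, plus the steady-source floor): SOME admissible family
of fields relaxes SOME smooth mean-zero profile ν-uniformly from every phase, with the floor. A theorem in kind for
prescribed fields (`Literature.Analysis.FluidPDE.HessChildsRowan2025_cor12` gives the relaxation half for every datum);
not formalised with the floor (ex item KinematicSteadySourceLaw, ~2.5k lines). -/
def KinematicWitness : Prop :=
  ∃ (ν : ℕ → ℝ) (v : ℕ → ℝ → 𝕋² → E²) (h : 𝕋² → ℝ),
    IsSmooth h ∧ HasZeroMean h ∧ KinematicBudget ν v ∧ ScalarClauses ν v h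

/-- **TRANSFER, typed.** X ↔ "a kinematic witness whose fields are steadily realised". The `→ KinematicWitness`
projection forgets exactly the conjunct `SteadilyRealised`, which is the entire crux. [folklore bookkeeping] -/
theorem crux_iff_kinematic_realised :
    UniformRelaxationWitness ↔
      ∃ (ν : ℕ → ℝ) (v : ℕ → ℝ → 𝕋² → E²) (h : 𝕋² → ℝ),
        IsSmooth h ∧ HasZeroMean h ∧ KinematicBudget ν v ∧ ScalarClauses ν v h ∧ SteadilyRealised ν v := by
  constructor
  · rintro ⟨g, h, hg, hgdiv, hgmean, hh, hhmean, ν, v₀, v, hνpos, hνlim, hLH, hbd, hE, hU, hA⟩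
    exact ⟨ν, v, h, hh, hhmean, ⟨hνpos, hνlim, hbd, hE⟩, ⟨hU, hA⟩, g, hg, hgdiv, hgmean, v₀, hLH⟩
  · rintro ⟨ν, v, h, hh, hhmean, ⟨hνpos, hνlim, hbd, hE⟩, ⟨hU, hA⟩, g, hg, hgdiv, hgmean, v₀, hLH⟩
    exact ⟨g, h, hg, hgdiv, hgmean, hh, hhmean, ν, v₀, v, hνpos, hνlim, hLH, hbd, hE, hU, hA⟩

/-- The projection the solved siblings reach: X ⇒ its kinematic sibling. [folklore bookkeeping] -/
theorem kinematicWitness_of_crux (hX : UniformRelaxationWitness) : KinematicWitness := by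
  obtain ⟨ν, v, h, hh, hhmean, hK, hS, -⟩ := crux_iff_kinematic_realised.1 hX
  exact ⟨ν, v, h, hh, hhmean, hK, hS⟩

/-! ## §S Strengthen: rigid forms `S⁺ ⊇ X` over the landed receptacle `UniformRelaxationWitnessUnder` -/

/-- Any strengthening by an extra hypothesis on the witness gives X (one line over the landed receptacle).
[folklore bookkeeping] -/
theorem crux_of_strengthening
    {H : (𝕋² → E²) → (𝕋² → ℝ) → (ℕ → ℝ) → (ℕ → ℝ → 𝕋² → E²) → Prop}
    (hS : UniformRelaxationWitnessUnder H) : UniformRelaxationWitness :=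
  uniformRelaxationWitnessUnder_true_iff.1 (hS.mono fun _ _ _ _ _ => trivial)

/-- S⁺₁ (exact recurrence; the dead line `Sketch`): the states are exactly `T_j`-periodic with `T_j ≤ T₀`. Buys the
phase quantifier (`relaxation_allPhases_of_periodic`, landed) and nothing toward the ν-uniform constant; needs
per-period strain → ∞ (`recurrentStates_false_without_unboundedPeriodStrain`, landed). -/
def PeriodicStates (_g : 𝕋² → E²) (_h : 𝕋² → ℝ) (_ν : ℕ → ℝ) (v : ℕ → ℝ → 𝕋² → E²) : Prop :=
  ∃ (T : ℕ → ℝ) (T₀ : ℝ), ∀ j, 0 < T j ∧ T j ≤ T₀ ∧ Function.Periodic (v j) (T j)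

/-- S⁺₂ (universal relaxer): ONE `(C, γ)` relaxes EVERY smooth mean-zero profile. Refutable in kind (Pr = 1 lock:
the vorticity is the crux's own scalar sourced by `curl g`, so `(U_{curl g})` + Duhamel bound the enstrophy,
contradicting `relaxingFamily_false_without_unboundedEnstrophy`; near-miss `Disproof.noUniversalRelaxer`, missing
only the weak vorticity formulation of planar Leray–Hopf solutions). A witness must be a SELECTIVE relaxer. -/
def AllProfiles (_g : 𝕋² → E²) (_h : 𝕋² → ℝ) (ν : ℕ → ℝ) (v : ℕ → ℝ → 𝕋² → E²) : Prop :=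
  ∃ C γ : ℝ, 0 ≤ C ∧ 0 < γ ∧ ∀ h' : 𝕋² → ℝ, IsSmooth h' → HasZeroMean h' → RelaxesUniformly ν v h' C γ

/-- S⁺₃ (pointwise energy, the line `Sketch`'s clause): harmless, and it yields the transport speed limit
`γ ≤ 2 log(4C)/τ_h` (FloorUpgrade `Negative/SpeedLimitSharp`), no more. -/
def PointwiseEnergy (_g : 𝕋² → E²) (_h : 𝕋² → ℝ) (_ν : ℕ → ℝ) (v : ℕ → ℝ → 𝕋² → E²) : Prop :=
  ∃ E : ℝ, ∀ j (t : ℝ), 0 ≤ t → ∫⁻ x, ‖v j t x‖ₑ ^ 2 ≤ ENNReal.ofReal E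

/-! ## §D Decomposition: the existing split and the only other shape -/

/-- The route's split (rev 6–9): `X ⇐ RelaxingFamily ∧ FloorUpgrade`, seam = modus ponens (`closes` uses `hF hR`).
Both pieces carry `no-strategy-short-of-summit` censuses (Cruxes/RelaxingFamily, Cruxes/FloorUpgrade, 2026-08-17).
[route AnomalousDissipation/LimitingAbsorption] -/
theorem crux_of_existingSplit (hR : RelaxingFamily) (hF : FloorUpgrade) : UniformRelaxationWitness := hF hR

/-- Piece 1 of a class split: an a-priori class `A` of admissible families relaxes the profile `h` with the floor
(a ∀-statement about prescribed fields — kinematic). -/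
def ClassRelaxes (A : (ℕ → ℝ) → (ℕ → ℝ → 𝕋² → E²) → Prop) (h : 𝕋² → ℝ) : Prop :=
  ∀ ν v, KinematicBudget ν v → A ν v → ScalarClauses ν v h

/-- Piece 2 of a class split: some steadily realised admissible family lies in the class `A` (scalar-free). -/
def ClassRealised (A : (ℕ → ℝ) → (ℕ → ℝ → 𝕋² → E²) → Prop) : Prop :=
  ∃ ν v, KinematicBudget ν v ∧ SteadilyRealised ν v ∧ A ν v

/-- **The class split, glue PROVED for every class `A`**: `ClassRelaxes A h → ClassRealised A → X`.
[folklore bookkeeping] -/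
theorem crux_of_classSplit (A : (ℕ → ℝ) → (ℕ → ℝ → 𝕋² → E²) → Prop) {h : 𝕋² → ℝ}
    (hh : IsSmooth h) (hhmean : HasZeroMean h) (h₁ : ClassRelaxes A h) (h₂ : ClassRealised A) :
    UniformRelaxationWitness := by
  obtain ⟨ν, v, hK, hR, hA⟩ := h₂
  exact crux_iff_kinematic_realised.2 ⟨ν, v, h, hh, hhmean, hK, h₁ ν v hK hA, hR⟩

/-- **Degenerate instance (costume check).** With `A :=` the scalar clauses themselves, piece 1 is a tautology and
piece 2 is X with the profile fixed — the split has content only through the CHOICE of an a-priori class `A`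
defined without reference to the scalar. [folklore bookkeeping] -/
theorem classSplit_degenerate (h : 𝕋² → ℝ) :
    ClassRelaxes (fun ν v => ScalarClauses ν v h) h ∧
      (IsSmooth h → HasZeroMean h → ClassRealised (fun ν v => ScalarClauses ν v h) → UniformRelaxationWitness) ∧
      (UniformRelaxationWitness → ∃ h' : 𝕋² → ℝ, ClassRealised (fun ν v => ScalarClauses ν v h')) := by
  refine ⟨fun _ _ _ hA => hA, fun hh hhm h₂ => crux_of_classSplit _ hh hhm (fun _ _ _ hA => hA) h₂, ?_⟩
  intro hX
  obtain ⟨ν, v, h', -, -, hK, hS, hR⟩ := crux_iff_kinematic_realised.1 hX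
  exact ⟨h', ν, v, hK, hR, hS⟩

/-! ## §N Negation: ¬X is exactly as far as a sub-logarithmic strain law -/

/-- A refutation of crux r3 kills X (landed, re-exported for the census). -/
theorem not_crux_of_not_relaxingFamily (hR : ¬ RelaxingFamily) : ¬ UniformRelaxationWitness :=
  uniformRelaxationWitness_false_of_not_relaxingFamily hR

/-- **The universal sub-logarithmic strain law** (Kraichnan–Batchelor side; OPEN — proved is only
`⟨‖∇v‖²⟩ ≲ ν^{-1/2}`, `Literature.Barriers.AnomalousDissipation.AlexakisDoering2006_energyDissipationBound`):
EVERY bounded-energy, locally bounded, steadily forced planar Leray–Hopf family along `ν_j → 0` lies in the landed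
excluded class `SublogEnstrophyBudget` (from some phase, homogeneous windowed budgets of `‖∇v_j‖_{L²}` of slope
`M_j = o(log(1/ν_j))`). -/
def SublogStrainLaw : Prop :=
  ∀ (g : 𝕋² → E²) (h : 𝕋² → ℝ) (ν : ℕ → ℝ) (v₀ : ℕ → 𝕋² → E²) (v : ℕ → ℝ → 𝕋² → E²),
    IsSmooth g → IsDivFree g → HasZeroMean g → (∀ j, 0 < ν j) → Tendsto ν atTop (𝓝 0) →
    (∀ j, IsGlobalLerayHopf (ν j) (fun _ => g) (v₀ j) (v j)) →
    (∀ j (T : ℝ), 0 < T → MemLp (stLift (v j)) ⊤ (volume.restrict (Ioo (0 : ℝ) T ×ˢ univ))) →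
    (∃ E : ℝ, ∀ j, meanEnergy (v j) ≤ E) → SublogEnstrophyBudget g h ν v

/-- **NEGATION, typed: `SublogStrainLaw → ¬ X`** — through the landed `relaxingFamily_false_without_logEnstrophy`
(Seis 2022 Rmk 1, windowed, + time dilation) and Part A of the Disproof (`h ≠ 0`: X-witnesses are
`RelaxingFamilyUnder` witnesses). [cite: Seis2022, Thm 2, Remark 1 (arXiv:2003.08794 p. 4)] -/
theorem not_crux_of_sublogStrainLaw (hL : SublogStrainLaw) : ¬ UniformRelaxationWitness := by
  intro hX
  obtain ⟨g, h, hg, hgd, hgm, hh, hhm, hh0, ν, v₀, v, hν, hνlim, hLH, hbd, hE, -, hU⟩ :=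
    (uniformRelaxationWitnessUnder_true_iff.2 hX).relaxingFamilyUnder
  exact relaxingFamily_false_without_logEnstrophy
    ⟨g, h, hg, hgd, hgm, hh, hhm, hh0, ν, v₀, v, hν, hνlim, hLH, hbd, hE,
      hL g h ν v₀ v hg hgd hgm hν hνlim hLH hbd hE, hU⟩

end Summit.AnomalousDissipation.AnomalousDissipation.Cruxes.UniformRelaxationWitness.StrategistR1

end
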